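import Summits.CriticalPhenomena.PercolationContinuityZ3.Theorems.PercNearOneGluingNoHeavyLowerTailSahiCombTriWPairLocal

/-!
# `TRI_W(a) ≥ 0` for the PUNCTURED fibre cube `P = W \ {∅}`, EVERY dimension `n` and EVERY index cube: the first pair-local certificate proved for all `n`

Support file of the one-cut programme (crux `NoHeavyLowerTail`, stmt-CriticalPhenomena-4575; cell `prim-masterthm`, seat P5 gen 23;
memo `FROM-prim-masterthm-p5-g23-PAIR-LOCAL.md` §3).  Target of the lane: `FiveUpSet.TriWIneq` (`…SahiCombTriWGeneral`, OPEN in general).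

The pair-local principle (`…SahiCombTriWPairLocal`) reduces `TriWIneq` for a test up-set `P ⊆ W = Finset γ` to a one-cube inequality.  For the
punctured cube `P₀ = W \ {∅}` (the up-set that is neither principal nor `refl`-closed — the case `n = 2` is `…TriWFibreTwo`) the LP certificates of
all small `n` have the uniform shape `κ = Σ_{e ∉ {∅,univ}} δ_(eᶜ,e) + δ_(univ,univ)`, and this certificate has a five-line proof for every `n`:
with `σ = 1_F + 1_F'`, the thin-edge functional of ARBITRARY (non-nested) pairs splits as
`triWOne P F F' G G' = ½ Σ_{A∈{F,F'},B∈{G,G'}} [Kl_{P∩B}(A) + Kl_{P∩A}(B)] + B_P(δ,ε)` (memo §3(a)); for `P = P₀` the relative gaps become the four ABSOLUTE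
Kleitman gaps `#(A∩B) − #(refl A ∩ B)` (`A ∈ {F,F'}`, `B ∈ {G,G'}`) up to boundary terms at `∅`/`univ`, the bilinear part is EXACTLY the certificate,
and the boundary terms have a sign because `∅ ∈ F ⟹ univ ∈ F` for an up-set.

* `FiveUpSet.card_punct_inter` — `#(P₀ ∩ X ∩ Y) = #(X ∩ Y) − [∅ ∈ X ∩ Y]`;
* **`FiveUpSet.pairPunct_le_triWOne`** — the one-cube inequality `Σ_{e ∉ {∅,univ}} sgnDiff F F' eᶜ · sgnDiff G G' e + sgnDiff F F' univ · sgnDiff G G' univ ≤ triWOne P₀ F F' G G'`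
  for ALL up-sets `F, F', G, G'` of `W`
  (= four Kleitman gaps + a signed boundary term; no nestedness);
* **`FiveUpSet.triW_nonneg_punctured`** — `0 ≤ triW (univ.erase ∅) F G` for EVERY finite `γ`, EVERY finite index type `β` and all monotone families of
  up-sets: `TriWIneq` for the punctured cube in all dimensions (sum the one-cube inequality over antipodal index pairs; `sum_sgnDiff_mul`).
HONEST LABEL: complete proofs, std axioms; a new unconditional stratum of `TriWIneq` (condition on `P` alone, all `a`, all `n`); general `P` stays OPEN. [this work]
-/

namespace Summit.CriticalPhenomena.PercolationContinuityZ3.Theorems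

namespace FiveUpSet

open Finset

variable {β γ : Type} [DecidableEq β] [Fintype β] [DecidableEq γ] [Fintype γ]

/-! ### Bookkeeping on the punctured cube -/

omit [DecidableEq β] [Fintype β] in
/-- `#(P₀ ∩ X ∩ Y) = #(X ∩ Y) − [∅ ∈ X ∧ ∅ ∈ Y]` for `P₀ = univ \ {∅}`. [this work] -/
theorem card_punct_inter (X Y : Finset (Finset γ)) :
    ((((univ : Finset (Finset γ)).erase ∅) ∩ X ∩ Y).card : ℤ) = (X ∩ Y).card - (if ∅ ∈ X ∧ ∅ ∈ Y then 1 else 0) := by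
  have hE : ((univ : Finset (Finset γ)).erase ∅) ∩ X ∩ Y = (X ∩ Y).erase ∅ := by
    ext s
    simp only [mem_inter, mem_erase, mem_univ, and_true]
    tauto
  rw [hE]
  by_cases h : ∅ ∈ X ∧ ∅ ∈ Y
  · have hm : (∅ : Finset γ) ∈ X ∩ Y := mem_inter.2 h
    rw [if_pos h, card_erase_of_mem hm]
    have : 1 ≤ (X ∩ Y).card := card_pos.2 ⟨∅, hm⟩
    omega
  · have hm : (∅ : Finset γ) ∉ X ∩ Y := fun h' => h (mem_inter.1 h')
    rw [if_neg h, erase_eq_of_notMem hm]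
    ring

omit [DecidableEq β] [Fintype β] in
/-- `#(refl A ∩ refl B) = #(A ∩ B)`. [this work] -/
theorem card_refl_inter_refl (A B : Finset (Finset γ)) : (refl A ∩ refl B).card = (A ∩ B).card := by
  rw [← refl_inter, card_refl]

omit [DecidableEq β] [Fintype β] in
/-- `#(A ∩ refl B) = #(refl A ∩ B)`. [this work] -/
theorem card_inter_refl_comm (A B : Finset (Finset γ)) : (A ∩ refl B).card = (refl A ∩ B).card := by
  rw [← card_refl (A ∩ refl B), refl_inter, refl_refl]

omit [DecidableEq β] [Fintype β] in
/-- `∅ ∈ refl A ↔ univ ∈ A`. [this work] -/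
theorem empty_mem_refl (A : Finset (Finset γ)) : (∅ : Finset γ) ∈ refl A ↔ (univ : Finset γ) ∈ A := by
  rw [mem_refl]
  simp

omit [DecidableEq β] [Fintype β] in
/-- `Σ_e sgnDiff F F' eᶜ · sgnDiff G G' e` in cards: `#(rF∩G) − #(rF∩G') − #(rF'∩G) + #(rF'∩G')`. [this work] -/
theorem sum_sgnDiff_compl_mul (F F' G G' : Finset (Finset γ)) :
    ∑ e : Finset γ, sgnDiff F F' eᶜ * sgnDiff G G' e
      = ((refl F ∩ G).card : ℤ) - (refl F ∩ G').card - (refl F' ∩ G).card + (refl F' ∩ G').card := by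
  have h1 : ∀ A B : Finset (Finset γ), ∑ e : Finset γ, (if eᶜ ∈ A then (1 : ℤ) else 0) * (if e ∈ B then (1 : ℤ) else 0)
      = ((refl A ∩ B).card : ℤ) := by
    intro A B
    have h : ∀ e : Finset γ, (if eᶜ ∈ A then (1 : ℤ) else 0) * (if e ∈ B then (1 : ℤ) else 0)
        = if e ∈ refl A ∩ B then (1 : ℤ) else 0 := by
      intro e
      by_cases ha : eᶜ ∈ A <;> by_cases hb : e ∈ B <;> simp [ha, hb, mem_refl]
    rw [Finset.sum_congr rfl (fun e _ => h e), Finset.sum_boole, Finset.filter_univ_mem]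
  have hx : ∀ e : Finset γ, sgnDiff F F' eᶜ * sgnDiff G G' e
      = (((if eᶜ ∈ F then (1 : ℤ) else 0) * (if e ∈ G then (1 : ℤ) else 0)
        - (if eᶜ ∈ F then (1 : ℤ) else 0) * (if e ∈ G' then (1 : ℤ) else 0))
        - (if eᶜ ∈ F' then (1 : ℤ) else 0) * (if e ∈ G then (1 : ℤ) else 0))
        + (if eᶜ ∈ F' then (1 : ℤ) else 0) * (if e ∈ G' then (1 : ℤ) else 0) := by
    intro e; unfold sgnDiff; ring
  rw [Finset.sum_congr rfl (fun e _ => hx e), sum_add_distrib, sum_sub_distrib, sum_sub_distrib, h1, h1, h1, h1]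

/-! ### The pair functional of the punctured cube and the one-cube inequality -/

omit [DecidableEq β] [Fintype β] in
/-- **The one-cube inequality for the punctured cube**: for ALL up-sets `F, F', G, G'` of a cube with `∅ ≠ univ`,
the certificate functional is at most `triWOne P₀ F F' G G'` (`P₀ = univ \ {∅}`).  Proof: the difference is the sum of the four Kleitman gaps `#(A∩B) − #(refl A ∩ B)`
(`A ∈ {F,F'}`, `B ∈ {G,G'}`) and of the boundary term `Σ_{(A,B)=(F,G),(F',G')} ([univ∈A][∅∈B] + [∅∈A][univ∈B] − 2[∅∈A][∅∈B]) ≥ 0`. [this work] -/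
theorem pairPunct_le_triWOne (hγ : (∅ : Finset γ) ≠ univ) (F F' G G' : Finset (Finset γ))
    (hF : IsUpperSet (F : Set (Finset γ))) (hF' : IsUpperSet (F' : Set (Finset γ)))
    (hG : IsUpperSet (G : Set (Finset γ))) (hG' : IsUpperSet (G' : Set (Finset γ))) :
    (∑ e ∈ ((univ : Finset (Finset γ)).erase ∅).erase univ, sgnDiff F F' eᶜ * sgnDiff G G' e
      + sgnDiff F F' univ * sgnDiff G G' univ)
      ≤ LatticeFiveUpSet.triWOne (complEquiv γ) (((univ : Finset (Finset γ)).erase ∅)) F F' G G' := by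
  -- (1) the pair functional in cards
  have hmemU : (univ : Finset γ) ∈ ((univ : Finset (Finset γ)).erase ∅) := mem_erase.2 ⟨fun h => hγ h.symm, mem_univ _⟩
  have hL : (∑ e ∈ ((univ : Finset (Finset γ)).erase ∅).erase univ, sgnDiff F F' eᶜ * sgnDiff G G' e
      + sgnDiff F F' univ * sgnDiff G G' univ)
      = (((refl F ∩ G).card : ℤ) - (refl F ∩ G').card - (refl F' ∩ G).card + (refl F' ∩ G').card)
        - sgnDiff F F' (∅ : Finset γ)ᶜ * sgnDiff G G' ∅ - sgnDiff F F' (univ : Finset γ)ᶜ * sgnDiff G G' univ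
        + sgnDiff F F' univ * sgnDiff G G' univ := by
    rw [← sum_sgnDiff_compl_mul, ← Finset.sum_erase_add _ _ (mem_univ (∅ : Finset γ)), ← Finset.sum_erase_add _ _ hmemU]
    ring
  rw [compl_empty, compl_univ] at hL
  -- (2) the thin-edge functional in cards
  have hT : LatticeFiveUpSet.triWOne (complEquiv γ) (((univ : Finset (Finset γ)).erase ∅)) F F' G G'
      = 2 * (((F ∩ G).card : ℤ) - (if ∅ ∈ F ∧ ∅ ∈ G then 1 else 0))
        + 2 * (((F' ∩ G').card : ℤ) - (if ∅ ∈ F' ∧ ∅ ∈ G' then 1 else 0))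
        - (((refl F ∩ G').card : ℤ) - (if univ ∈ F ∧ ∅ ∈ G' then 1 else 0))
        - (((refl F' ∩ G).card : ℤ) - (if univ ∈ F' ∧ ∅ ∈ G then 1 else 0))
        - (((refl F ∩ G').card : ℤ) - (if ∅ ∈ F ∧ univ ∈ G' then 1 else 0))
        - (((refl F' ∩ G).card : ℤ) - (if ∅ ∈ F' ∧ univ ∈ G then 1 else 0))
        - (((F ∩ G).card : ℤ) - (if univ ∈ F ∧ univ ∈ G then 1 else 0))
        - (((F' ∩ G').card : ℤ) - (if univ ∈ F' ∧ univ ∈ G' then 1 else 0))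
        + (((F ∩ G').card : ℤ) - (if univ ∈ F ∧ univ ∈ G' then 1 else 0))
        + (((F' ∩ G).card : ℤ) - (if univ ∈ F' ∧ univ ∈ G then 1 else 0)) := by
    unfold LatticeFiveUpSet.triWOne
    simp only [image_complEquiv]
    simp only [card_punct_inter]
    simp only [empty_mem_refl, card_inter_refl_comm, refl_refl]
    ring
  -- (3) Kleitman gaps and boundary signs
  have k1 := card_refl_inter_le hG hF
  have k2 := card_refl_inter_le hG' hF
  have k3 := card_refl_inter_le hG hF'
  have k4 := card_refl_inter_le hG' hF'
  have upF : (∅ : Finset γ) ∈ F → (univ : Finset γ) ∈ F := fun h => hF (empty_subset _) h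
  have upF' : (∅ : Finset γ) ∈ F' → (univ : Finset γ) ∈ F' := fun h => hF' (empty_subset _) h
  have upG : (∅ : Finset γ) ∈ G → (univ : Finset γ) ∈ G := fun h => hG (empty_subset _) h
  have upG' : (∅ : Finset γ) ∈ G' → (univ : Finset γ) ∈ G' := fun h => hG' (empty_subset _) h
  rw [hL, hT]
  unfold sgnDiff
  by_cases f0 : (∅ : Finset γ) ∈ F <;> by_cases f1 : (univ : Finset γ) ∈ F <;>
  by_cases f0' : (∅ : Finset γ) ∈ F' <;> by_cases f1' : (univ : Finset γ) ∈ F' <;>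
  by_cases g0 : (∅ : Finset γ) ∈ G <;> by_cases g1 : (univ : Finset γ) ∈ G <;>
  by_cases g0' : (∅ : Finset γ) ∈ G' <;> by_cases g1' : (univ : Finset γ) ∈ G' <;>
  simp only [f0, f1, f0', f1', g0, g1, g0', g1', and_self, and_true, and_false, if_true, if_false] <;>
  first | omega | exact absurd (upF f0) f1 | exact absurd (upF' f0') f1' | exact absurd (upG g0) g1 | exact absurd (upG' g0') g1'

/-! ### The theorem -/

/-- **`TriWIneq` for the punctured cube, every dimension.**  For EVERY finite `γ`, EVERY finite index type `β` and all monotone families `F, G` of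
up-sets of `Finset γ`: `0 ≤ triW (univ.erase ∅) F G`.  Proof: sum `pairPunct_le_triWOne` over the antipodal index pairs (`two_mul_triW`); the left-hand
sides add up to `Σ_{e ∉ {∅,univ}} 2·Kl(α_{eᶜ}, β_e) + 2·Kl(α_univ, β_univ) ≥ 0` (`sum_sgnDiff_mul_nonneg`). [this work] -/
theorem triW_nonneg_punctured (F G : Finset β → Finset (Finset γ))
    (hF : ∀ x, IsUpperSet (F x : Set (Finset γ))) (hG : ∀ x, IsUpperSet (G x : Set (Finset γ)))
    (hFm : Monotone F) (hGm : Monotone G) :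
    0 ≤ triW (((univ : Finset (Finset γ)).erase ∅)) F G := by
  by_cases hγ : (∅ : Finset γ) = univ
  · -- degenerate cube: `P₀ = ∅`
    have hP : ((univ : Finset (Finset γ)).erase ∅) = ∅ := by
      ext s
      simp only [mem_erase, mem_univ, and_true, Finset.notMem_empty, iff_false, not_not]
      have : s ⊆ (univ : Finset γ) := subset_univ s
      rw [← hγ] at this
      exact subset_empty.1 this
    rw [hP]
    unfold triW triWTerm
    simp
  -- sum the one-cube inequality over the index cube
  have hsum : ∑ x : Finset β, (∑ e ∈ ((univ : Finset (Finset γ)).erase ∅).erase univ, sgnDiff (F x) (F xᶜ) eᶜ * sgnDiff (G x) (G xᶜ) e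
      + sgnDiff (F x) (F xᶜ) univ * sgnDiff (G x) (G xᶜ) univ)
      ≤ ∑ x : Finset β, LatticeFiveUpSet.triWOne (complEquiv γ) (((univ : Finset (Finset γ)).erase ∅)) (F x) (F xᶜ) (G x) (G xᶜ) :=
    sum_le_sum fun x _ => pairPunct_le_triWOne hγ (F x) (F xᶜ) (G x) (G xᶜ) (hF x) (hF xᶜ) (hG x) (hG xᶜ)
  rw [← two_mul_triW] at hsum
  have hL : 0 ≤ ∑ x : Finset β, (∑ e ∈ ((univ : Finset (Finset γ)).erase ∅).erase univ, sgnDiff (F x) (F xᶜ) eᶜ * sgnDiff (G x) (G xᶜ) e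
      + sgnDiff (F x) (F xᶜ) univ * sgnDiff (G x) (G xᶜ) univ) := by
    rw [sum_add_distrib, sum_comm]
    refine add_nonneg (sum_nonneg fun e _ => sum_sgnDiff_mul_nonneg hFm hGm eᶜ e) (sum_sgnDiff_mul_nonneg hFm hGm univ univ)
  linarith

end FiveUpSet

end Summit.CriticalPhenomena.PercolationContinuityZ3.Theorems
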